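import Summits.AtomisticToContinuum.Crystallization.Theorems.PalmUnimodularRigidityLayeredLawsSelectHcpRelaxedReference
import Summits.AtomisticToContinuum.Crystallization.Theorems.ExcessDecayLiouvilleCoarseGrainsHcpEnergySeries

/-!
# The relaxed Lennard-Jones hcp lattice exists
(stub `stub_optimalHcp` of line `registered` (birth skeleton), crux `CoerciveVarianceCertificate`,
stmt-AtomisticToContinuum-11860, route `PRVarianceCertificate`)

Some `a, h > 0` minimise the Lennard-Jones energy per particle of `hcpPeriodicConfiguration` (in-layer
spacing `a`, layer spacing `h`) over ALL parameters `a', h' ≠ 0` (signs included).  Proof — bookkeeping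
over landed facts, all `[folklore]`:

* `PalmUnimodularRigidity.LayeredLawsSelectHcp.stub_relaxedReference` (landed): the TOTAL function
  `hcpE a h = ½ ∑_{v ≠ 0} V_LJ(√(a² Q v + k² h²))` has a global minimiser `(a₀, h₀)` over the open quadrant
  `{a > 0, h > 0}`, with `189/200 ≤ a₀` and `77/100 ≤ h₀` (so `a₀, h₀ > 0`);
* `ExcessDecayLiouvilleCoarseGrains.hcpEnergySeries_of_eq` (landed, third clause): for `a, h ≠ 0`,
  `(hcpPeriodicConfiguration ha hh).energyPerParticle lennardJones = hcpE a h`;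
* `hcpE` depends on `(a, h)` only through `(a², h²)`, so `hcpE |a| |h| = hcpE a h` (`sq_abs`), which moves
  every nonzero `(a', h')` into the open quadrant.
-/

noncomputable section

namespace Summit.AtomisticToContinuum.Crystallization.Theorems.PRVarianceCertificate.CoerciveVarianceCertificate

open Literature.MathematicalPhysics.StatisticalMechanics
open Summit.AtomisticToContinuum.Crystallization.Theorems.PalmUnimodularRigidity.LayeredLawsSelectHcp
  (hcpE hcpQ stub_relaxedReference)
open Summit.AtomisticToContinuum.Crystallization.Theorems.ExcessDecayLiouvilleCoarseGrains
  (hcpEnergySeries_of_eq)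

/-- `hcpE a h = e(hcp a h)` for `a, h ≠ 0`: third clause of the landed series theorem
`hcpEnergySeries_of_eq` (the right-hand side of that clause is `hcpE a h` by `rfl`). [folklore] -/
private theorem optimalHcp_hcpE_eq_energyPerParticle {a h : ℝ} (ha : a ≠ 0) (hh : h ≠ 0) :
    hcpE a h = (hcpPeriodicConfiguration ha hh).energyPerParticle lennardJones :=
  ((hcpEnergySeries_of_eq a h ha hh hcpQ rfl).2.2).symm

/-- `hcpE` is even in each variable: `hcpE |a| |h| = hcpE a h` (it depends on `a ^ 2`, `h ^ 2` only;
`sq_abs`). [folklore] -/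
private theorem optimalHcp_hcpE_abs (a h : ℝ) : hcpE |a| |h| = hcpE a h := by
  simp only [hcpE, sq_abs]

/-- **Stub `stub_optimalHcp` of line `registered` (birth), crux `CoerciveVarianceCertificate`
(stmt-AtomisticToContinuum-11860): THE RELAXED LENNARD-JONES hcp LATTICE EXISTS.**  Some `a, h > 0` minimise
the Lennard-Jones energy per particle of `hcpPeriodicConfiguration` over all parameters `a', h' ≠ 0`:
take the landed global minimiser `(a₀, h₀)` of `hcpE` over the open quadrant (`stub_relaxedReference`;
`a₀ ≥ 189/200`, `h₀ ≥ 77/100`), read both energies as `hcpE` (`hcpEnergySeries_of_eq`), and fold the signs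
of `(a', h')` by evenness (`hcpE a' h' = hcpE |a'| |h'|`). [folklore] -/
theorem stub_optimalHcp : ∃ (a h : ℝ) (ha : 0 < a) (hh : 0 < h), (∀ (a' h' : ℝ) (ha' : a' ≠ 0) (hh' : h' ≠ 0), (Literature.MathematicalPhysics.StatisticalMechanics.hcpPeriodicConfiguration ha.ne' hh.ne').energyPerParticle Literature.MathematicalPhysics.StatisticalMechanics.lennardJones ≤ (Literature.MathematicalPhysics.StatisticalMechanics.hcpPeriodicConfiguration ha' hh').energyPerParticle Literature.MathematicalPhysics.StatisticalMechanics.lennardJones) := by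
  obtain ⟨a₀, h₀, ha₁, -, hh₁, -, hmin⟩ := stub_relaxedReference
  have ha0 : 0 < a₀ := by linarith
  have hh0 : 0 < h₀ := by linarith
  refine ⟨a₀, h₀, ha0, hh0, fun a' h' ha' hh' => ?_⟩
  rw [← optimalHcp_hcpE_eq_energyPerParticle ha0.ne' hh0.ne', ← optimalHcp_hcpE_eq_energyPerParticle ha' hh',
    ← optimalHcp_hcpE_abs a' h']
  exact hmin |a'| |h'| (abs_pos.2 ha') (abs_pos.2 hh')

end Summit.AtomisticToContinuum.Crystallization.Theorems.PRVarianceCertificate.CoerciveVarianceCertificate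

end
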